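import Mathlib
import Summits.Ventures.PercRepro2.Defs
import Summits.Ventures.PercRepro2.Graph
import Summits.Ventures.PercRepro2.Harris
import Summits.Ventures.PercRepro2.VdBKahn

/-!
# The pendant-root candidate (Z″) and its competition term (blind cell PercRepro2, p2 g35)

The candidate (C1-PEND) = (Z″) of proofs/P2-G34-ROOT.md §2 lives on the graph `G − a₁` with root
`a₂`, attachment vertex `v` and marks `o`, `b`: with `F = {v ↔ a₂}`, `O = {o ↔ a₂}`, `B = {b ↔ a₂}`,
`R = {v ↮ a₂} ∩ {o ↔ v}` and `p = P(Fᶜ)`,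

  `(Z″)   p² · Cov(O, B) + Cov(O, F) · Cov(B, F) ≥ P(R) · Cov(B, F)`.

This file records the exact **three-term decomposition** of the cleared quantity `zpp` (`q · zpp =
p² · T₁ + p · q · T₂ + T₃ · T₄`, `q = P(F)`) and the signs of its pieces: `T₂ ≥ 0` is van den
Berg–Kahn's positive association of `O`, `B` in the `v`-avoiding world (`vdBK_pair`), `T₃ ≥ 0` and
`T₄ ≥ 0` are Harris for the increasing events `E = O ∪ {o ↔ v}` (on `F` it is `O`) and `B` against
`F`.  The only unsigned piece is the **competition term** `T₁ = P(O ∩ B ∩ F) · P(F) − P(O ∩ F) ·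
P(B ∩ F)` (the covariance of `O` and `B` given `v ↔ a₂`, which is negative when `o` and `b` carry
competing routes from `a₂` to `v`).  Hence `(Z″)` holds whenever `T₁ ≥ 0`
(`zpp_nonneg_of_competition_nonneg`), and in general `(Z″) ⟺ p² · T₁ + p · q · T₂ + T₃ · T₄ ≥ 0`:
the candidate is exactly the statement that the competition deficit is paid by the vdBK and Harris
surpluses (neither alone suffices — exact witnesses in P2-G35-PENDZ.md).  Std axioms.
-/

namespace Summit.Ventures.PercRepro2

namespace RowC1

section PendZ

variable {V : Type*} {E : Type*} [Fintype E] [DecidableEq E] [Fintype V] [DecidableEq V]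
  {R : Type*} [Field R] [LinearOrder R] [IsStrictOrderedRing R]

/-- The cleared pendant-root quantity `(Z″)`:
`p² · Cov(O,B) + Cov(O,F) · Cov(B,F) − P(R) · Cov(B,F)` with `F = connEvent a₂ v`,
`O = connEvent a₂ o`, `B = connEvent a₂ b`, `R = Fᶜ ∩ connEvent v o`, `p = P(Fᶜ)`. -/
noncomputable def zpp (p : E → R) (ends : E → Sym2 V) (v a₂ o b : V) : R :=
  (prob p (connEvent ends a₂ v)ᶜ) ^ 2 *
      (prob p (connEvent ends a₂ o ∩ connEvent ends a₂ b) -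
        prob p (connEvent ends a₂ o) * prob p (connEvent ends a₂ b)) +
    (prob p (connEvent ends a₂ o ∩ connEvent ends a₂ v) -
        prob p (connEvent ends a₂ o) * prob p (connEvent ends a₂ v)) *
      (prob p (connEvent ends a₂ b ∩ connEvent ends a₂ v) -
        prob p (connEvent ends a₂ b) * prob p (connEvent ends a₂ v)) -
    prob p ((connEvent ends a₂ v)ᶜ ∩ connEvent ends v o) *
      (prob p (connEvent ends a₂ b ∩ connEvent ends a₂ v) -
        prob p (connEvent ends a₂ b) * prob p (connEvent ends a₂ v))

/-- The competition term `T₁ = P(O ∩ B ∩ F) · P(F) − P(O ∩ F) · P(B ∩ F)`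
(`= P(F)² · Cov(O, B | F)`). -/
noncomputable def zppCompetition (p : E → R) (ends : E → Sym2 V) (v a₂ o b : V) : R :=
  prob p (connEvent ends a₂ o ∩ connEvent ends a₂ b ∩ connEvent ends a₂ v) *
      prob p (connEvent ends a₂ v) -
    prob p (connEvent ends a₂ o ∩ connEvent ends a₂ v) *
      prob p (connEvent ends a₂ b ∩ connEvent ends a₂ v)

/-- The van den Berg–Kahn term `T₂ = P(O ∩ B ∩ Fᶜ) · P(Fᶜ) − P(O ∩ Fᶜ) · P(B ∩ Fᶜ)`
(`= P(Fᶜ)² · Cov(O, B | Fᶜ)`). -/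
noncomputable def zppAvoid (p : E → R) (ends : E → Sym2 V) (v a₂ o b : V) : R :=
  prob p (connEvent ends a₂ o ∩ connEvent ends a₂ b ∩ (connEvent ends a₂ v)ᶜ) *
      prob p (connEvent ends a₂ v)ᶜ -
    prob p (connEvent ends a₂ o ∩ (connEvent ends a₂ v)ᶜ) *
      prob p (connEvent ends a₂ b ∩ (connEvent ends a₂ v)ᶜ)

/-- The merged-cluster shift `T₃ = P(O ∩ F) · P(Fᶜ) − (P(O ∩ Fᶜ) + P(R)) · P(F)`
(`= P(F) P(Fᶜ) · (P(E | F) − P(E | Fᶜ))` for `E = {o ↔ a₂} ∪ {o ↔ v}`). -/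
noncomputable def zppShiftO (p : E → R) (ends : E → Sym2 V) (v a₂ o : V) : R :=
  prob p (connEvent ends a₂ o ∩ connEvent ends a₂ v) * prob p (connEvent ends a₂ v)ᶜ -
    (prob p (connEvent ends a₂ o ∩ (connEvent ends a₂ v)ᶜ) +
        prob p ((connEvent ends a₂ v)ᶜ ∩ connEvent ends v o)) *
      prob p (connEvent ends a₂ v)

/-- The `b`-shift `T₄ = P(B ∩ F) · P(Fᶜ) − P(B ∩ Fᶜ) · P(F)` (`= P(F) P(Fᶜ) · (P(B | F) − P(B | Fᶜ))`). -/
noncomputable def zppShiftB (p : E → R) (ends : E → Sym2 V) (v a₂ b : V) : R :=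
  prob p (connEvent ends a₂ b ∩ connEvent ends a₂ v) * prob p (connEvent ends a₂ v)ᶜ -
    prob p (connEvent ends a₂ b ∩ (connEvent ends a₂ v)ᶜ) * prob p (connEvent ends a₂ v)

omit [Fintype V] [DecidableEq V] [LinearOrder R] [IsStrictOrderedRing R] in
/-- **The three-term decomposition**: `P(F) · zpp = P(Fᶜ)² · T₁ + P(Fᶜ) · P(F) · T₂ + T₃ · T₄`
(pure algebra from the total-probability splits over `F`). -/
theorem prob_mul_zpp_eq (p : E → R) (ends : E → Sym2 V) (v a₂ o b : V) :
    prob p (connEvent ends a₂ v) * zpp p ends v a₂ o b =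
      (prob p (connEvent ends a₂ v)ᶜ) ^ 2 * zppCompetition p ends v a₂ o b +
        prob p (connEvent ends a₂ v)ᶜ * prob p (connEvent ends a₂ v) * zppAvoid p ends v a₂ o b +
        zppShiftO p ends v a₂ o * zppShiftB p ends v a₂ b := by
  have hOB := prob_inter_add_prob_inter_compl p (connEvent ends a₂ o ∩ connEvent ends a₂ b)
    (connEvent ends a₂ v)
  have hO := prob_inter_add_prob_inter_compl p (connEvent ends a₂ o) (connEvent ends a₂ v)
  have hB := prob_inter_add_prob_inter_compl p (connEvent ends a₂ b) (connEvent ends a₂ v)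
  have hF := prob_compl p (connEvent ends a₂ v)
  unfold zpp zppCompetition zppAvoid zppShiftO zppShiftB
  rw [hF] at *
  rw [← hOB, ← hO, ← hB]
  ring

omit [Fintype E] [DecidableEq E] [Fintype V] [DecidableEq V] in
/-- `{o ↔ a₂} ∪ {o ↔ v}` meets `{v ↔ a₂}` exactly where `{o ↔ a₂}` does. -/
lemma union_inter_conn_eq (ends : E → Sym2 V) (v a₂ o : V) :
    (connEvent ends a₂ o ∪ connEvent ends v o) ∩ connEvent ends a₂ v =
      connEvent ends a₂ o ∩ connEvent ends a₂ v := by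
  ext ω
  simp only [Set.mem_inter_iff, Set.mem_union, mem_connEvent]
  constructor
  · rintro ⟨h | h, hF⟩
    · exact ⟨h, hF⟩
    · exact ⟨conn_trans hF h, hF⟩
  · rintro ⟨h, hF⟩
    exact ⟨Or.inl h, hF⟩

omit [Fintype E] [DecidableEq E] [Fintype V] [DecidableEq V] in
/-- Off `{v ↔ a₂}` the events `{o ↔ a₂}` and `{o ↔ v}` are disjoint. -/
lemma disjoint_conn_compl (ends : E → Sym2 V) (v a₂ o : V) :
    Disjoint (connEvent ends a₂ o ∩ (connEvent ends a₂ v)ᶜ)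
      ((connEvent ends a₂ v)ᶜ ∩ connEvent ends v o) := by
  rw [Set.disjoint_left]
  rintro ω ⟨hO, hF⟩ ⟨_, hvo⟩
  exact hF (conn_trans hO (conn_symm hvo))

omit [Fintype V] [DecidableEq V] [LinearOrder R] [IsStrictOrderedRing R] in
/-- `P(E ∩ Fᶜ) = P(O ∩ Fᶜ) + P(R)` for `E = {o ↔ a₂} ∪ {o ↔ v}`. -/
lemma prob_union_inter_compl_eq (p : E → R) (ends : E → Sym2 V) (v a₂ o : V) :
    prob p ((connEvent ends a₂ o ∪ connEvent ends v o) ∩ (connEvent ends a₂ v)ᶜ) =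
      prob p (connEvent ends a₂ o ∩ (connEvent ends a₂ v)ᶜ) +
        prob p ((connEvent ends a₂ v)ᶜ ∩ connEvent ends v o) := by
  rw [← prob_union_of_disjoint p (disjoint_conn_compl ends v a₂ o)]
  congr 1
  ext ω
  simp only [Set.mem_inter_iff, Set.mem_union, Set.mem_compl_iff]
  tauto

/-- **`T₂ ≥ 0`** — van den Berg–Kahn: `O` and `B` are positively associated given `v ↮ a₂`. -/
theorem zppAvoid_nonneg (p : E → R) (hp : IsProbVec p) (ends : E → Sym2 V) (v a₂ o b : V) :
    0 ≤ zppAvoid p ends v a₂ o b := by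
  have h := vdBK_pair p hp ends a₂ o b v
  unfold zppAvoid
  linarith

omit [Fintype V] [DecidableEq V] in
/-- **`T₄ ≥ 0`** — Harris for `B` and `F`. -/
theorem zppShiftB_nonneg (p : E → R) (hp : IsProbVec p) (ends : E → Sym2 V) (v a₂ b : V) :
    0 ≤ zppShiftB p ends v a₂ b := by
  have h := prob_mul_prob_le_prob_inter hp (isUpperSet_connEvent ends a₂ b)
    (isUpperSet_connEvent ends a₂ v)
  have hB := prob_inter_add_prob_inter_compl p (connEvent ends a₂ b) (connEvent ends a₂ v)
  have hF := prob_compl p (connEvent ends a₂ v)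
  unfold zppShiftB
  rw [hF]
  have key : prob p (connEvent ends a₂ b ∩ connEvent ends a₂ v) *
        (1 - prob p (connEvent ends a₂ v)) -
      prob p (connEvent ends a₂ b ∩ (connEvent ends a₂ v)ᶜ) * prob p (connEvent ends a₂ v) =
      prob p (connEvent ends a₂ b ∩ connEvent ends a₂ v) -
        prob p (connEvent ends a₂ b) * prob p (connEvent ends a₂ v) := by
    rw [← hB]; ring
  rw [key]
  linarith

omit [Fintype V] [DecidableEq V] in
/-- **`T₃ ≥ 0`** — Harris for the increasing event `E = {o ↔ a₂} ∪ {o ↔ v}` (the merged cluster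
reaches `o`) and `F`; on `F` the event `E` is `O`. -/
theorem zppShiftO_nonneg (p : E → R) (hp : IsProbVec p) (ends : E → Sym2 V) (v a₂ o : V) :
    0 ≤ zppShiftO p ends v a₂ o := by
  have h := prob_mul_prob_le_prob_inter hp
    ((isUpperSet_connEvent ends a₂ o).union (isUpperSet_connEvent ends v o))
    (isUpperSet_connEvent ends a₂ v)
  have hE := prob_inter_add_prob_inter_compl p (connEvent ends a₂ o ∪ connEvent ends v o)
    (connEvent ends a₂ v)
  rw [union_inter_conn_eq, prob_union_inter_compl_eq] at hE
  rw [union_inter_conn_eq] at h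
  have hF := prob_compl p (connEvent ends a₂ v)
  unfold zppShiftO
  rw [hF]
  have key : prob p (connEvent ends a₂ o ∩ connEvent ends a₂ v) *
        (1 - prob p (connEvent ends a₂ v)) -
      (prob p (connEvent ends a₂ o ∩ (connEvent ends a₂ v)ᶜ) +
          prob p ((connEvent ends a₂ v)ᶜ ∩ connEvent ends v o)) * prob p (connEvent ends a₂ v) =
      prob p (connEvent ends a₂ o ∩ connEvent ends a₂ v) -
        prob p (connEvent ends a₂ o ∪ connEvent ends v o) * prob p (connEvent ends a₂ v) := by
    rw [← hE]; ring
  rw [key]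
  linarith

/-- **`(Z″)` holds whenever the competition term is nonnegative**, i.e. whenever `O` and `B` are
non-negatively correlated given `v ↔ a₂`: `P(O ∩ F) · P(B ∩ F) ≤ P(O ∩ B ∩ F) · P(F) ⟹ 0 ≤ zpp`.
(The cut-vertex families and the `o`-pendant equality family of P2-G34-ROOT §2 are instances.) -/
theorem zpp_nonneg_of_competition_nonneg (p : E → R) (hp : IsProbVec p) (ends : E → Sym2 V)
    (v a₂ o b : V) (h1 : 0 ≤ zppCompetition p ends v a₂ o b) :
    0 ≤ zpp p ends v a₂ o b := by
  have hq : 0 ≤ prob p (connEvent ends a₂ v) := prob_nonneg hp _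
  have hpc : 0 ≤ prob p (connEvent ends a₂ v)ᶜ := prob_nonneg hp _
  have h2 := zppAvoid_nonneg p hp ends v a₂ o b
  have h3 := zppShiftO_nonneg p hp ends v a₂ o
  have h4 := zppShiftB_nonneg p hp ends v a₂ b
  have hid := prob_mul_zpp_eq p ends v a₂ o b
  rcases hq.lt_or_eq with hpos | hzero
  · have : 0 ≤ prob p (connEvent ends a₂ v) * zpp p ends v a₂ o b := by
      rw [hid]
      have := mul_nonneg (pow_nonneg hpc 2) h1
      have := mul_nonneg (mul_nonneg hpc hq) h2
      have := mul_nonneg h3 h4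
      linarith
    exact (mul_nonneg_iff_of_pos_left hpos).1 this
  · -- `P(F) = 0`: the covariances with `F` vanish and `(Z″)` is Harris for `O`, `B`.
    have hOF : prob p (connEvent ends a₂ o ∩ connEvent ends a₂ v) = 0 :=
      le_antisymm (by rw [hzero]; exact prob_inter_le_right hp _ _) (prob_nonneg hp _)
    have hBF : prob p (connEvent ends a₂ b ∩ connEvent ends a₂ v) = 0 :=
      le_antisymm (by rw [hzero]; exact prob_inter_le_right hp _ _) (prob_nonneg hp _)
    have hH := prob_mul_prob_le_prob_inter hp (isUpperSet_connEvent ends a₂ o)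
      (isUpperSet_connEvent ends a₂ b)
    unfold zpp
    rw [← hzero, hOF, hBF]
    simp only [mul_zero, sub_zero, sub_self, add_zero]
    exact mul_nonneg (pow_nonneg hpc 2) (by linarith)

end PendZ

end RowC1

end Summit.Ventures.PercRepro2

/-! ## (Z″) as a quantitative BHK slack (p2 g35; proofs/P2-G35-PENDZ.md §5)

With `F = {v ↔ a₂}`, `O = {o ↔ a₂}`, `B = {b ↔ a₂}`, `E = O ∪ {o ↔ v}` and `p = P(Fᶜ)`,
`zpp = p · S − P(E ∩ Fᶜ) · Cov(B, F)` with `S := p · P(O ∩ B) − P(O) · P(B ∩ Fᶜ)` the «Harris twice»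
slack (`P(B | O) ≥ P(B) ≥ P(B | v ↮ a₂)`; the BHK/vdBK instance with `X = ∅`, `Y = {v}`).  So `(Z″)`
says that this slack is at least `P(o ↔ {v, a₂} | v ↮ a₂) · Cov(B, F)`, and **`(Z″)` holds whenever
`P(E ∩ Fᶜ) ≤ P(Fᶜ) · P(O)`** — whenever `o` is no more likely to reach the pair `{v, a₂}` given
`v ↮ a₂` than to reach `a₂` outright (`zpp_nonneg_of_merged_le`) — the other half of the region left
open by `zpp_nonneg_of_competition_nonneg`. -/

namespace Summit.Ventures.PercRepro2

namespace RowC1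

section PendZSlack

variable {V : Type*} {E : Type*} [Fintype E] [DecidableEq E]
  {R : Type*} [Field R] [LinearOrder R] [IsStrictOrderedRing R]

/-- The «Harris twice» slack `S = P(Fᶜ) · P(O ∩ B) − P(O) · P(B ∩ Fᶜ)`. -/
noncomputable def zppSlack (p : E → R) (ends : E → Sym2 V) (v a₂ o b : V) : R :=
  prob p (connEvent ends a₂ v)ᶜ * prob p (connEvent ends a₂ o ∩ connEvent ends a₂ b) -
    prob p (connEvent ends a₂ o) * prob p (connEvent ends a₂ b ∩ (connEvent ends a₂ v)ᶜ)

omit [LinearOrder R] [IsStrictOrderedRing R] in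
/-- **`zpp = P(Fᶜ) · S − P(E ∩ Fᶜ) · Cov(B, F)`** with `P(E ∩ Fᶜ) = P(O ∩ Fᶜ) + P(R)`. -/
theorem zpp_eq_slack (p : E → R) (ends : E → Sym2 V) (v a₂ o b : V) :
    zpp p ends v a₂ o b =
      prob p (connEvent ends a₂ v)ᶜ * zppSlack p ends v a₂ o b -
        (prob p (connEvent ends a₂ o ∩ (connEvent ends a₂ v)ᶜ) +
            prob p ((connEvent ends a₂ v)ᶜ ∩ connEvent ends v o)) *
          (prob p (connEvent ends a₂ b ∩ connEvent ends a₂ v) -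
            prob p (connEvent ends a₂ b) * prob p (connEvent ends a₂ v)) := by
  have hO := prob_inter_add_prob_inter_compl p (connEvent ends a₂ o) (connEvent ends a₂ v)
  have hB := prob_inter_add_prob_inter_compl p (connEvent ends a₂ b) (connEvent ends a₂ v)
  have hF := prob_compl p (connEvent ends a₂ v)
  unfold zpp zppSlack
  rw [hF] at *
  rw [← hO, ← hB]
  ring

/-- **`S ≥ 0`** — Harris twice: `P(O) P(B) ≤ P(O ∩ B)` and `P(B) P(F) ≤ P(B ∩ F)`. -/
theorem zppSlack_nonneg (p : E → R) (hp : IsProbVec p) (ends : E → Sym2 V) (v a₂ o b : V) :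
    0 ≤ zppSlack p ends v a₂ o b := by
  have h1 := prob_mul_prob_le_prob_inter hp (isUpperSet_connEvent ends a₂ o)
    (isUpperSet_connEvent ends a₂ b)
  have h2 := prob_mul_prob_le_prob_inter hp (isUpperSet_connEvent ends a₂ b)
    (isUpperSet_connEvent ends a₂ v)
  have hB := prob_inter_add_prob_inter_compl p (connEvent ends a₂ b) (connEvent ends a₂ v)
  have hF := prob_compl p (connEvent ends a₂ v)
  have hO := prob_nonneg hp (connEvent ends a₂ o)
  have hq := prob_nonneg hp (connEvent ends a₂ v)
  have hpc := prob_nonneg hp (connEvent ends a₂ v)ᶜ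
  unfold zppSlack
  rw [hF] at *
  have key : (1 - prob p (connEvent ends a₂ v)) *
        prob p (connEvent ends a₂ o ∩ connEvent ends a₂ b) -
      prob p (connEvent ends a₂ o) * prob p (connEvent ends a₂ b ∩ (connEvent ends a₂ v)ᶜ) =
      (1 - prob p (connEvent ends a₂ v)) *
          (prob p (connEvent ends a₂ o ∩ connEvent ends a₂ b) -
            prob p (connEvent ends a₂ o) * prob p (connEvent ends a₂ b)) +
        prob p (connEvent ends a₂ o) *
          (prob p (connEvent ends a₂ b ∩ connEvent ends a₂ v) -
            prob p (connEvent ends a₂ b) * prob p (connEvent ends a₂ v)) := by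
    rw [← hB]; ring
  rw [key]
  have := mul_nonneg hpc (sub_nonneg.2 h1)
  have := mul_nonneg hO (sub_nonneg.2 h2)
  linarith

/-- **`(Z″)` holds whenever `P(E ∩ Fᶜ) ≤ P(Fᶜ) · P(O)`**, i.e. whenever
`P(o ↔ {v, a₂} | v ↮ a₂) ≤ P(o ↔ a₂)`: then `zpp ≥ P(Fᶜ)² · Cov(O, B) ≥ 0`. -/
theorem zpp_nonneg_of_merged_le (p : E → R) (hp : IsProbVec p) (ends : E → Sym2 V)
    (v a₂ o b : V)
    (h : prob p (connEvent ends a₂ o ∩ (connEvent ends a₂ v)ᶜ) +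
        prob p ((connEvent ends a₂ v)ᶜ ∩ connEvent ends v o) ≤
      prob p (connEvent ends a₂ v)ᶜ * prob p (connEvent ends a₂ o)) :
    0 ≤ zpp p ends v a₂ o b := by
  have h1 := prob_mul_prob_le_prob_inter hp (isUpperSet_connEvent ends a₂ o)
    (isUpperSet_connEvent ends a₂ b)
  have h2 := prob_mul_prob_le_prob_inter hp (isUpperSet_connEvent ends a₂ b)
    (isUpperSet_connEvent ends a₂ v)
  have hB := prob_inter_add_prob_inter_compl p (connEvent ends a₂ b) (connEvent ends a₂ v)
  have hF := prob_compl p (connEvent ends a₂ v)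
  have hpc := prob_nonneg hp (connEvent ends a₂ v)ᶜ
  rw [zpp_eq_slack]
  -- `zpp ≥ p · S − p · P(O) · Cov(B,F) = p² · Cov(O,B)`
  have hcov : 0 ≤ prob p (connEvent ends a₂ b ∩ connEvent ends a₂ v) -
      prob p (connEvent ends a₂ b) * prob p (connEvent ends a₂ v) := sub_nonneg.2 h2
  have hstep := mul_le_mul_of_nonneg_right h hcov
  have key : prob p (connEvent ends a₂ v)ᶜ * zppSlack p ends v a₂ o b -
      prob p (connEvent ends a₂ v)ᶜ * prob p (connEvent ends a₂ o) *
        (prob p (connEvent ends a₂ b ∩ connEvent ends a₂ v) -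
          prob p (connEvent ends a₂ b) * prob p (connEvent ends a₂ v)) =
      (prob p (connEvent ends a₂ v)ᶜ) ^ 2 *
        (prob p (connEvent ends a₂ o ∩ connEvent ends a₂ b) -
          prob p (connEvent ends a₂ o) * prob p (connEvent ends a₂ b)) := by
    unfold zppSlack
    rw [hF] at *
    rw [← hB]; ring
  have := mul_nonneg (pow_nonneg hpc 2) (sub_nonneg.2 h1)
  linarith

end PendZSlack

end RowC1

end Summit.Ventures.PercRepro2
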